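/-
Copyright (c) 2026 the pub-hodgecm-mathlib formalisation cell (harness21).  Prover seat hodgecm-mathlib-F0P3a-p08 (g18): «S3-ram» seeding wave (LEAD F0P3a-plan (g12)
T11-41; owner p06 (g15); RANK-CM tame-ramified twin, holder A-p19 (g26)), organ (r1-place) — the unipotent classes of `U(3)` at a tamely ramified PLACE; 2026-09-01.
-/
import Literature.NumberTheory.Automorphic.UnitaryThreeUnipotentClassesRamified      -- ★ p846834 (this seat): the generic valued-field layer (`exists_norm_mul_eq_of_fixed`, `sq_zero_unipotent_cases_ramified`, `not_exists_conj_cornerUnipotent_of_not_norm`)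
import Literature.NumberTheory.LocalFields.RamifiedPlaceUnitNorms                    -- ★ p846833 F0P2-p01 (g14): (U2) `exists_fixed_unit_not_norm_of_ramified`, (U3) `exists_mul_galAdicCompletionMap_eq_or_of_ramified`, (U5) `valued_sub_mul_galAdicCompletionMap_eq_one_of_not_isSquare_residue`
import Literature.NumberTheory.Automorphic.RamifiedPlaceAntiFixedUniformizer          -- ★ `exists_uniformizer_galAdicCompletionMap_eq_neg_of_ramified`; brings ★ Liu2021 `valued_galAdicCompletionMap_sub_lt_one_of_ramified`
import Literature.NumberTheory.Automorphic.UnitaryGroupInertPlaceHyperbolicBasis      -- ★ `galAdicCompletionMap_galAdicCompletionMap_of_smul_eq` (`σ_w² = id`)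
import HarnessLib

/-!
# The unipotent classes of `U(3)` at a TAMELY RAMIFIED place `w ∣ v` of a quadratic extension `E ∕ F` of number fields (`e(w|v) ≠ 1`, `|2|_w = 1`): the
# `σ_w`-fixed dichotomy `E_w^{σ} ∖ 0 = N(E_w^×) ⊔ ε·N(E_w^×)` with ONE non-norm unit `ε`, and the singular classes `1`, `[n(ϖ)]`, `[n(εϖ)]`

Topic `NumberTheory/Automorphic`; namespace `Literature.NumberTheory.Automorphic.UnitaryGroup`.  THEOREMS ONLY (no definition, no instance, no notation, no named fact,
no `sorry`); kernel lane `--supports stmt-HodgeConjecture-24833`.  Cell `pub/hodgecm-mathlib` (D-0151), crux H413; «S3-ram» seeding wave (LEAD T11-41, owner p06 (g15));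
row «RANK-CM ram twin» (head A-p19 (g26), `UnipotentOrbitalIntegralLevelPiecesRamifiedCM`): this file is organ **(r1-place)** — the PLACE DRESS of ★ p846834
`UnitaryThreeUnipotentClassesRamified` (generic valued field), i.e. A-p19's interface (i)+(ii) (bus 21:21:45Z) VERBATIM: for `σ_w = galAdicCompletionMap c hw` on `E_w`,
ONE `σ_w`-fixed unit `ε` with `|ε − σ_w z·z|_w = 1` for all integral `z` (the `hε` token of ★ `ResidueSquareClassLevelPiece`, p846824), `ε` not a norm, and every non-zero
`σ_w`-fixed `s` equal to `z·σ_w z` or `ε·(z·σ_w z)` with `z ≠ 0`; then, for ANY uniformiser `ϖ` with `σ_w ϖ = −ϖ`, the singular unipotent classes of `U(σ_w, J₀)(E_w)` are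
`1`, `[n(ϖ)]`, `[n(εϖ)]`, the last two distinct.
DISCHARGES (all ★): `ε` and its three properties = ★ p846833 (U2) `exists_fixed_unit_not_norm_of_ramified` + (U5) `valued_sub_mul_galAdicCompletionMap_eq_one_of_not_isSquare_residue`;
the unit dichotomy = (U3) `exists_mul_galAdicCompletionMap_eq_or_of_ramified`; the passage from units to all fixed `s ≠ 0` = ★ p846834 `exists_norm_mul_eq_of_fixed` over an
anti-fixed uniformiser (★ `exists_uniformizer_galAdicCompletionMap_eq_neg_of_ramified`), residual triviality (★ Liu2021 `valued_galAdicCompletionMap_sub_lt_one_of_ramified`),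
`σ_w² = id` (★ `galAdicCompletionMap_galAdicCompletionMap_of_smul_eq`) and `|σ_w ·| = |·|` (★ `valued_galAdicCompletionMap`).
HONEST LABEL: HC_CM is proved only modulo the 2 remaining named inputs (hLiu418 24832, h413 24833) until rung 0 closes; nothing printed is asserted here.

## References
* [Serre1979] J.-P. Serre, *Local Fields*, GTM 67 (1979), Ch. V §3 Prop. 5, Cor. 2 p. 86 (`U_K ∕ N U_L` cyclic of order 2, totally ramified tame).
* [Rogawski1990] J. D. Rogawski, *Automorphic Representations of Unitary Groups in Three Variables* (1990), §3.9 p. 32 (the singular classes `t mod N E^×`).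
* [LabesseLanglands1979] J.-P. Labesse, R. P. Langlands, *L-indistinguishability for SL(2)*, Canad. J. Math. 31 (1979), §2 pp. 8–9.
-/

set_option autoImplicit false

noncomputable section

open scoped Matrix MatrixGroups Valued WithZero
open Matrix NumberField IsDedekindDomain

namespace Literature.NumberTheory.Automorphic.UnitaryGroup

open Literature.NumberTheory.Automorphic.HermitianLattice Literature.NumberTheory.Automorphic.UnitaryLatticeTree
open Literature.NumberTheory.Automorphic.Liu2021 Literature.NumberTheory.LocalFields.RamifiedPlaceUnitNorms

/-! ## §1 Generic quadratic extension `E ∕ F` -/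

section Generic

variable {F : Type} (E : Type) [Field F] [NumberField F] [Field E] [NumberField E] [Algebra F E] [Algebra.IsQuadraticExtension F E]
  (c : E ≃ₐ[F] E) (hc : c ≠ 1) (v : HeightOneSpectrum (𝓞 F)) (w : PlacesOver E v) (hw : c • w.1 = w.1)

include hc in
/-- **THE `σ_w`-FIXED DICHOTOMY AT A TAMELY RAMIFIED PLACE, WITH ONE NON-NORM UNIT `ε`** (`e(w|v) ≠ 1`, `|2|_w = 1`): there is a `σ_w`-fixed unit `ε` of `E_w` with
`|ε − σ_w z·z|_w = 1` for every integral `z`, which is not a norm `t·σ_w t`, and every non-zero `σ_w`-fixed `s ∈ E_w` is `z·σ_w z` or `ε·(z·σ_w z)` for some `z ≠ 0`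
(`F_v^× ∕ N(E_w^×) ≅ U_v ∕ N(U_w) ≅ 𝓀_vˣ ∕ 𝓀_vˣ²` has order `2`). [cite: Serre1979, Ch. V §3 Cor. 2 p. 86] [cite: LabesseLanglands1979, §2 pp. 8–9] -/
theorem exists_fixed_unit_norm_dichotomy_of_ramified (he : v.asIdeal.ramificationIdx' w.1.asIdeal ≠ 1)
    (h2 : Valued.v (2 : w.1.adicCompletion E) = 1) :
    ∃ ε : w.1.adicCompletion E, galAdicCompletionMap (L := E) c hw ε = ε ∧ Valued.v ε = 1 ∧
      (∀ z : w.1.adicCompletion E, Valued.v z ≤ 1 → Valued.v (ε - galAdicCompletionMap (L := E) c hw z * z) = 1) ∧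
      (¬ ∃ t : w.1.adicCompletion E, t * galAdicCompletionMap (L := E) c hw t = ε) ∧
      ∀ s : w.1.adicCompletion E, s ≠ 0 → galAdicCompletionMap (L := E) c hw s = s →
        ∃ z : w.1.adicCompletion E, z ≠ 0 ∧
          (s = z * galAdicCompletionMap (L := E) c hw z ∨ s = ε * (z * galAdicCompletionMap (L := E) c hw z)) := by
  obtain ⟨ε, hε1, hσε, hns, hεN⟩ := exists_fixed_unit_not_norm_of_ramified E c hc v w hw he h2
  obtain ⟨ϖ, hvϖ, hσϖ⟩ := exists_uniformizer_galAdicCompletionMap_eq_neg_of_ramified E c hc w hw he h2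
  refine ⟨ε, hσε, hε1, valued_sub_mul_galAdicCompletionMap_eq_one_of_not_isSquare_residue E c hc v w hw he hε1 hns, hεN, fun s hs hσs => ?_⟩
  have hU : ∀ u : w.1.adicCompletion E, galAdicCompletionMap (L := E) c hw u = u → Valued.v u = 1 →
      ∃ z : w.1.adicCompletion E, z * galAdicCompletionMap (L := E) c hw z = u ∨ ε * (z * galAdicCompletionMap (L := E) c hw z) = u := by
    intro u hσu hvu
    obtain ⟨t, -, ht⟩ := exists_mul_galAdicCompletionMap_eq_or_of_ramified E c hc v w hw he h2 hε1 hσε hns hvu hσu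
    exact ⟨t, ht⟩
  exact exists_norm_mul_eq_of_fixed (galAdicCompletionMap (L := E) c hw) (galAdicCompletionMap_galAdicCompletionMap_of_smul_eq c w hc hw)
    (valued_galAdicCompletionMap E c hw) hvϖ hσϖ (fun x hx => LemD1IndexedNonVacuityRamifiedConverse.valued_galAdicCompletionMap_sub_lt_one_of_ramified E c v hc w hw he x hx) h2 hU hσs hs

include hc in
/-- **THE SINGULAR UNIPOTENT CLASSES OF `U(σ_w, J₀)(E_w)` AT A TAMELY RAMIFIED PLACE ARE `1`, `[n(ϖ)]`, `[n(εϖ)]`** — for ANY uniformiser `ϖ` with `σ_w ϖ = −ϖ` and any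
`ε` carrying the fixed dichotomy of `exists_fixed_unit_norm_dichotomy_of_ramified` (★ p846834 `sq_zero_unipotent_cases_ramified`, dressed).
[cite: Rogawski1990, §3.9 p. 32, Prop. 3.9.1] [cite: Serre1979, Ch. V §3 Cor. 2 p. 86] -/
theorem sq_zero_unipotent_cases_of_ramified (he : v.asIdeal.ramificationIdx' w.1.asIdeal ≠ 1)
    (h2 : Valued.v (2 : w.1.adicCompletion E) = 1) {ϖ : w.1.adicCompletion E} (hvϖ : Valued.v ϖ = WithZero.exp (-1 : ℤ))
    (hσϖ : galAdicCompletionMap (L := E) c hw ϖ = -ϖ) {ε : w.1.adicCompletion E}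
    (hdich : ∀ s : w.1.adicCompletion E, s ≠ 0 → galAdicCompletionMap (L := E) c hw s = s →
      ∃ z : w.1.adicCompletion E, z ≠ 0 ∧
        (s = z * galAdicCompletionMap (L := E) c hw z ∨ s = ε * (z * galAdicCompletionMap (L := E) c hw z)))
    {n₀ n₁ : GL (Fin 3) (w.1.adicCompletion E)}
    (hn₀ : (n₀ : Matrix (Fin 3) (Fin 3) (w.1.adicCompletion E)) = !![1, 0, ϖ; 0, 1, 0; 0, 0, 1])
    (hn₁ : (n₁ : Matrix (Fin 3) (Fin 3) (w.1.adicCompletion E)) = !![1, 0, ε * ϖ; 0, 1, 0; 0, 0, 1])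
    {g : GL (Fin 3) (w.1.adicCompletion E)}
    (hg : g ∈ unitaryGroupOfForm (galAdicCompletionMap (L := E) c hw) ((StdForm.antidiagonal 3).over (w.1.adicCompletion E)))
    (hsq : ((g : Matrix (Fin 3) (Fin 3) (w.1.adicCompletion E)) - 1) * ((g : Matrix (Fin 3) (Fin 3) (w.1.adicCompletion E)) - 1) = 0) :
    g = 1 ∨
      (∃ k : GL (Fin 3) (w.1.adicCompletion E),
        k ∈ unitaryGroupOfForm (galAdicCompletionMap (L := E) c hw) ((StdForm.antidiagonal 3).over (w.1.adicCompletion E)) ∧ k * g * k⁻¹ = n₀) ∨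
      (∃ k : GL (Fin 3) (w.1.adicCompletion E),
        k ∈ unitaryGroupOfForm (galAdicCompletionMap (L := E) c hw) ((StdForm.antidiagonal 3).over (w.1.adicCompletion E)) ∧ k * g * k⁻¹ = n₁) := by
  have hU : ∀ u : w.1.adicCompletion E, galAdicCompletionMap (L := E) c hw u = u → Valued.v u = 1 →
      ∃ z : w.1.adicCompletion E, z * galAdicCompletionMap (L := E) c hw z = u ∨ ε * (z * galAdicCompletionMap (L := E) c hw z) = u := by
    intro u hσu hvu
    obtain ⟨z, -, hz⟩ := hdich u (fun h0 => by rw [h0, map_zero] at hvu; exact zero_ne_one hvu) hσu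
    exact ⟨z, hz.imp Eq.symm Eq.symm⟩
  exact sq_zero_unipotent_cases_ramified (galAdicCompletionMap (L := E) c hw) (galAdicCompletionMap_galAdicCompletionMap_of_smul_eq c w hc hw)
    (valued_galAdicCompletionMap E c hw) hvϖ hσϖ (fun x hx => LemD1IndexedNonVacuityRamifiedConverse.valued_galAdicCompletionMap_sub_lt_one_of_ramified E c v hc w hw he x hx) h2 hU hn₀ hn₁ hg hsq

include hc in
/-- **`n(ϖ) ≁ n(εϖ)`** in `U(σ_w, J₀)(E_w)` when `ε` is not a norm `t·σ_w t` (★ p846834 `not_exists_conj_cornerUnipotent_of_not_norm`, dressed).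
[cite: Rogawski1990, §3.9 p. 32] -/
theorem not_exists_conj_cornerUnipotent_of_ramified {ϖ : w.1.adicCompletion E} (hϖ : ϖ ≠ 0) {ε : w.1.adicCompletion E}
    (hε : ¬ ∃ t : w.1.adicCompletion E, t * galAdicCompletionMap (L := E) c hw t = ε)
    {n₀ n₁ : GL (Fin 3) (w.1.adicCompletion E)}
    (hn₀ : (n₀ : Matrix (Fin 3) (Fin 3) (w.1.adicCompletion E)) = !![1, 0, ϖ; 0, 1, 0; 0, 0, 1])
    (hn₁ : (n₁ : Matrix (Fin 3) (Fin 3) (w.1.adicCompletion E)) = !![1, 0, ε * ϖ; 0, 1, 0; 0, 0, 1]) :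
    ¬ ∃ k : GL (Fin 3) (w.1.adicCompletion E),
        k ∈ unitaryGroupOfForm (galAdicCompletionMap (L := E) c hw) ((StdForm.antidiagonal 3).over (w.1.adicCompletion E)) ∧ k * n₀ * k⁻¹ = n₁ :=
  not_exists_conj_cornerUnipotent_of_not_norm (galAdicCompletionMap (L := E) c hw) (galAdicCompletionMap_galAdicCompletionMap_of_smul_eq c w hc hw) hϖ hε hn₀ hn₁

end Generic

/-! ## §2 CM dress (`E = L` CM, `F = L⁺`, `c` = complex conjugation) -/

section CM

variable (L : Type) [Field L] [NumberField L] [IsCMField L] {v : HeightOneSpectrum (𝓞 ↥(maximalRealSubfield L))}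
  (w : PlacesOver L v) (hw : IsCMField.complexConj L • w.1 = w.1)

/-- The `σ_w`-fixed dichotomy with one non-norm unit, for a CM extension `L ∕ L⁺` at a tamely ramified place. [cite: Serre1979, Ch. V §3 Cor. 2 p. 86] -/
theorem exists_fixed_unit_norm_dichotomy_of_ramified_complexConj (he : v.asIdeal.ramificationIdx' w.1.asIdeal ≠ 1)
    (h2 : Valued.v (2 : w.1.adicCompletion L) = 1) :
    ∃ ε : w.1.adicCompletion L, galAdicCompletionMap (L := L) (IsCMField.complexConj L) hw ε = ε ∧ Valued.v ε = 1 ∧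
      (∀ z : w.1.adicCompletion L, Valued.v z ≤ 1 → Valued.v (ε - galAdicCompletionMap (L := L) (IsCMField.complexConj L) hw z * z) = 1) ∧
      (¬ ∃ t : w.1.adicCompletion L, t * galAdicCompletionMap (L := L) (IsCMField.complexConj L) hw t = ε) ∧
      ∀ s : w.1.adicCompletion L, s ≠ 0 → galAdicCompletionMap (L := L) (IsCMField.complexConj L) hw s = s →
        ∃ z : w.1.adicCompletion L, z ≠ 0 ∧
          (s = z * galAdicCompletionMap (L := L) (IsCMField.complexConj L) hw z ∨
            s = ε * (z * galAdicCompletionMap (L := L) (IsCMField.complexConj L) hw z)) :=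
  haveI : Algebra.IsQuadraticExtension ↥(maximalRealSubfield L) L := IsCMField.isQuadraticExtension L
  exists_fixed_unit_norm_dichotomy_of_ramified L (IsCMField.complexConj L) (IsCMField.complexConj_ne_one L) v w hw he h2

/-- The singular unipotent classes `1`, `[n(ϖ)]`, `[n(εϖ)]` of `U(σ_w, J₀)(L_w)`, CM extension, tamely ramified place. [cite: Rogawski1990, §3.9 p. 32, Prop. 3.9.1] -/
theorem sq_zero_unipotent_cases_of_ramified_complexConj (he : v.asIdeal.ramificationIdx' w.1.asIdeal ≠ 1)
    (h2 : Valued.v (2 : w.1.adicCompletion L) = 1) {ϖ : w.1.adicCompletion L} (hvϖ : Valued.v ϖ = WithZero.exp (-1 : ℤ))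
    (hσϖ : galAdicCompletionMap (L := L) (IsCMField.complexConj L) hw ϖ = -ϖ) {ε : w.1.adicCompletion L}
    (hdich : ∀ s : w.1.adicCompletion L, s ≠ 0 → galAdicCompletionMap (L := L) (IsCMField.complexConj L) hw s = s →
      ∃ z : w.1.adicCompletion L, z ≠ 0 ∧
        (s = z * galAdicCompletionMap (L := L) (IsCMField.complexConj L) hw z ∨
          s = ε * (z * galAdicCompletionMap (L := L) (IsCMField.complexConj L) hw z)))
    {n₀ n₁ : GL (Fin 3) (w.1.adicCompletion L)}
    (hn₀ : (n₀ : Matrix (Fin 3) (Fin 3) (w.1.adicCompletion L)) = !![1, 0, ϖ; 0, 1, 0; 0, 0, 1])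
    (hn₁ : (n₁ : Matrix (Fin 3) (Fin 3) (w.1.adicCompletion L)) = !![1, 0, ε * ϖ; 0, 1, 0; 0, 0, 1])
    {g : GL (Fin 3) (w.1.adicCompletion L)}
    (hg : g ∈ unitaryGroupOfForm (galAdicCompletionMap (L := L) (IsCMField.complexConj L) hw) ((StdForm.antidiagonal 3).over (w.1.adicCompletion L)))
    (hsq : ((g : Matrix (Fin 3) (Fin 3) (w.1.adicCompletion L)) - 1) * ((g : Matrix (Fin 3) (Fin 3) (w.1.adicCompletion L)) - 1) = 0) :
    g = 1 ∨
      (∃ k : GL (Fin 3) (w.1.adicCompletion L),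
        k ∈ unitaryGroupOfForm (galAdicCompletionMap (L := L) (IsCMField.complexConj L) hw) ((StdForm.antidiagonal 3).over (w.1.adicCompletion L)) ∧
          k * g * k⁻¹ = n₀) ∨
      (∃ k : GL (Fin 3) (w.1.adicCompletion L),
        k ∈ unitaryGroupOfForm (galAdicCompletionMap (L := L) (IsCMField.complexConj L) hw) ((StdForm.antidiagonal 3).over (w.1.adicCompletion L)) ∧
          k * g * k⁻¹ = n₁) :=
  haveI : Algebra.IsQuadraticExtension ↥(maximalRealSubfield L) L := IsCMField.isQuadraticExtension L
  sq_zero_unipotent_cases_of_ramified L (IsCMField.complexConj L) (IsCMField.complexConj_ne_one L) v w hw he h2 hvϖ hσϖ hdich hn₀ hn₁ hg hsq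

/-- `n(ϖ) ≁ n(εϖ)` in `U(σ_w, J₀)(L_w)` when `ε` is not a norm, CM extension. [cite: Rogawski1990, §3.9 p. 32] -/
theorem not_exists_conj_cornerUnipotent_of_ramified_complexConj {ϖ : w.1.adicCompletion L} (hϖ : ϖ ≠ 0) {ε : w.1.adicCompletion L}
    (hε : ¬ ∃ t : w.1.adicCompletion L, t * galAdicCompletionMap (L := L) (IsCMField.complexConj L) hw t = ε)
    {n₀ n₁ : GL (Fin 3) (w.1.adicCompletion L)}
    (hn₀ : (n₀ : Matrix (Fin 3) (Fin 3) (w.1.adicCompletion L)) = !![1, 0, ϖ; 0, 1, 0; 0, 0, 1])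
    (hn₁ : (n₁ : Matrix (Fin 3) (Fin 3) (w.1.adicCompletion L)) = !![1, 0, ε * ϖ; 0, 1, 0; 0, 0, 1]) :
    ¬ ∃ k : GL (Fin 3) (w.1.adicCompletion L),
        k ∈ unitaryGroupOfForm (galAdicCompletionMap (L := L) (IsCMField.complexConj L) hw) ((StdForm.antidiagonal 3).over (w.1.adicCompletion L)) ∧
          k * n₀ * k⁻¹ = n₁ :=
  haveI : Algebra.IsQuadraticExtension ↥(maximalRealSubfield L) L := IsCMField.isQuadraticExtension L
  not_exists_conj_cornerUnipotent_of_ramified L (IsCMField.complexConj L) (IsCMField.complexConj_ne_one L) v w hw hϖ hε hn₀ hn₁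

end CM

end Literature.NumberTheory.Automorphic.UnitaryGroup

end
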